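import Summits.BirchSwinnertonDyer.BirchSwinnertonDyer.Theorems.ThetaPartnerAtTwoSignedMainConjectureCMTwoRankZeroReductions
import Summits.BirchSwinnertonDyer.BirchSwinnertonDyer.Theorems.ThetaPartnerAtTwoSignedMainConjectureCMTwoPeriodUnit
import HarnessLib

/-!
# Route `ThetaPartnerAtTwo`, crux K2r `SignedMainConjectureCMTwoRankZero` (item stmt-BirchSwinnertonDyer-20312):
# NECESSITY of the research stubs of line `rankzero` — the crux at a curve forces bottom-layer signed
# control at `2`, the analytic `μ(L♭) = 0`, and (with BSD₂) Kim's control term at `2`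

HONEST FRAMING (cell `pub/bsd-wall`, W-ALL row 1, prover seat `bsd-wall-tp2-p2`, successor g2): the crux
(Pollack–Rubin 2004 Thm. 7.3 ported to `p = 2` with `μ⁺ = 0`, for CM curves `A/ℚ` of analytic rank `0`,
good supersingular at `2`, `a₂ = 0`) is NOT in print at `2` and is NOT proved here. The registered
skeleton `rankzero` (v7, sha16 fd96cde8f62ba52b; siblings p518019, p519461, p523402, p526353, p527678)
composes the crux from four research stubs — (T2_A) `Sel⁺(A/ℚ_∞)^γ` finite at the normalised
cyclotomic pairs, (K4c_A) B. D. Kim's control term at `2`, (E_A) the Eisenstein half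
`KobayashiLowerDivisibility A 2 1`, (μ♭_A) a unit coefficient of Kobayashi's `L⁺ = L♭` — plus the
published inputs BY NAME. This file (route-independent: no `Theses` module is imported) proves that
each research stub is IMPLIED by the crux at the curve (the companion file `…RankZeroLossless.lean`
assembles the equivalence):

* §1 `finite_signedSelmerInvariants_of_kobayashiMainConjecture_two_one` — for `W` good at `2` with
  `a₂ = 0` and `L(W,1) ≠ 0` (modularity by name): `KobayashiMainConjecture W 2 1` ⇒ `Sel⁺(W/ℚ_∞)^γ`
  is finite at every normalised cyclotomic pair (the conjecture gives `char X⁺ = (g)`, `ι g = ϖ·ι L♭`,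
  so `g(0) = L(W,1)/Ω_W ≠ 0` by Sprung's `c♭ = 1`; Greenberg's Lemma 4.2 `f(0) ≠ 0 ⇒ X/TX` finite,
  tree `IwasawaAlgebra.finite_coinvariants_of_constantCoeff_ne_zero`; Pontryagin duality
  `IsDualPair.finite_coinvariants_iff`). So (T2_A) ⇐ crux.
* §2 `exists_isUnit_coeff_kobayashiL_of_mu_eq_zero_two` — `KobayashiMainConjecture W 2 1` + `μ⁺ = 0`
  at the normalised pairs + the period fact (`ord₂ ϖ = 0`, p522394/p523402) ⇒ for EVERY newform `f`
  of `W` and EVERY Pollack pair at `2`, `L♭` has a unit coefficient (`μ(X⁺) = 0` iff a generator of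
  `char X⁺` has a unit coefficient, tree `muInvariant_eq_zero_iff_exists_isUnit_coeff_of_charIdeal_eq_span`;
  transfer along `ι L♭ = ϖ⁻¹·ι g`). So (μ♭_A) ⇐ crux.
* §3 `kimControlTerm_two_of_kobayashiMainConjecture_two_one` — `KobayashiMainConjecture W 2 1` +
  `BSDp W 2` + GZK (`L(W,1) ≠ 0`, good supersingular at `2`, `a₂ = 0`) ⇒ Kim's control term at `2` at
  the normalised pairs: EVERY generator `g` of `char X⁺` has `g(0) = u·2^{v₂ ∏c_ℓ}·#Sel_{2^∞}(W/ℚ)`,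
  `u ∈ ℤ₂ˣ` (`g(0) ∼ L(W,1)/Ω_W`; BSD₂ reads `ord₂ L/Ω = ord₂ ∏c + ord₂ #Ш`; `#Sel_{2^∞} = #Ш[2^∞]` in
  rank `0`; `2 ∤ #tors`). For CM `A` of analytic rank `0`, BSD₂(A) is Burungale–Flach. So (K4c_A at the
  normalised pairs) ⇐ crux + PUB. (E_A) ⇐ crux is the tree's `kobayashiLowerDivisibility_of_mainConjecture`.
So any refutation of (T2_A), (μ♭_A) or (K4c_A, normalised) — e.g. a rank-`0` CM class at which Kim's
term carries an extra `2`-power, or a twist with `μ(L♭) > 0` — refutes the crux itself. Nothing about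
any curve is asserted; the published inputs are named facts taken as hypotheses.

References: [Kobayashi2003] Thm. 1.2, (3.6), Conjecture (p. 2); [BDKim2013] Cor. 3.15 (p odd in print);
[GreenbergLNM1716] §1 pp. 54, 60, Lemma 4.2 (pp. 102–103); [BurungaleFlach2024] Thm. 1.1;
[Sprung2017] Thm. 1.12, Cor. 4.4; [Washington1997] §7.1, §13.2; [GreenbergVatsal2000] p. 2 and §3 Rem. 3.4;
[AbbesUllmo1996] Thm. A; [Miller2011LMS] Def. 1.1.
-/

set_option autoImplicit false
-- the Theorems namespace of this sub repeats the summit name by design (D-0017 nested layout)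
set_option linter.dupNamespace false

noncomputable section

open scoped Classical MatrixGroups ModularForm

open CongruenceSubgroup WeierstrassCurve Literature.NumberTheory.EllipticCurves
  Literature.NumberTheory.EllipticCurves.ModularForms Literature.NumberTheory.EllipticCurves.Sprung2017
  Literature.NumberTheory.EllipticCurves.Rank1Residual Literature.NumberTheory.EllipticCurves.Rank1Residual.Typed
  Literature.NumberTheory.EllipticCurves.Kobayashi2003 ZpExtension
  Literature.NumberTheory.EllipticCurves.IwasawaDual
  Summit.BirchSwinnertonDyer.Rank1Residual Summit.BirchSwinnertonDyer.Rank1Residual.Supersingular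

namespace Summit.BirchSwinnertonDyer.BirchSwinnertonDyer.Theorems

/-! ## §1. The main conjecture at `2` forces bottom-layer signed control (finite `Sel⁺(W/ℚ_∞)^γ`) in rank `0` -/

section FiniteInvariants
variable (A : WeierstrassCurve ℚ) [A.IsElliptic] [A.IsGloballyMinimal]

/-- **The `+` main conjecture at `2` forces bottom-layer signed control in rank `0`.** Let `W/ℚ` be
globally minimal with good reduction at `2`, `a₂ = 0` and `L(W,1) ≠ 0`, and grant modularity (`hmod`,
PUB, by name). If `KobayashiMainConjecture W 2 1` holds then, for every cyclotomic `ℤ₂`-extension `κ`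
with a topological generator `γ` matching the cyclotomic variable, `Sel⁺(W/ℚ_∞)^γ` — the kernel of
`conj_γ − 1` on `signedSelmerInfty W κ 1` — is FINITE. Chain: a newform `f`, its period ratio `ϖ > 0`
and a Pollack pair at `2` exist (`exists_isPollackPair_two`, Sprung); for a dual datum `D`
(`nonempty_signedSelmerDualData`; `X⁺` is finitely generated, `SignedSelmerDualData.moduleFinite`) the
conjecture gives `X⁺` torsion, `char X⁺ = (g)`, `ι g = ϖ·ι L♭`, whence `g(0) = ϖ·[0]⁺_f = L(W,1)/Ω_W ≠ 0`
(`constantCoeff_neronPlus_two_eq`, `c♭ = 1`); Greenberg's Lemma 4.2 gives `X⁺/TX⁺` finite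
(`IwasawaAlgebra.finite_coinvariants_of_constantCoeff_ne_zero`) and Pontryagin duality
(`IsDualPair.finite_coinvariants_iff`) gives `Sel⁺_∞^γ` finite. This is the registered stub
`stub_finiteInvariantsCMTwo` of line `rankzero` read backwards: (T2_A) is NECESSARY for the crux.
[cite: GreenbergLNM1716, §4 Lemma 4.2 (pp. 102–103)] [cite: Kobayashi2003, Conjecture (p. 2) and (3.6)]
[cite: Sprung2017, Thm. 1.12 and Cor. 4.4] -/
theorem finite_signedSelmerInvariants_of_kobayashiMainConjecture_two_one
    (hmod : nonempty_modularParametrizationData)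
    (hgood : A.HasGoodReductionAtPrime 2) (ha : A.frobeniusTrace 2 = 0)
    (hL : A.entireLFunction 1 ≠ 0) (hMC : KobayashiMainConjecture A 2 1)
    {κ : ZpExtension ℚ 2} {γ : Field.absoluteGaloisGroup ℚ} (hκ : κ.IsCyclotomic)
    (hγ : κ.IsTopGenerator γ) (hγ' : IsCyclotomicVariable 2 γ) :
    Finite (endInvariants (conjSignedSelmerInfty A κ 1 γ - 1)) := by
  -- modularity: a newform `f` of `A`, its period ratio `ϖ`, a Pollack pair at `2`, a dual datum
  haveI : NeZero (A.conductorNorm ℤ) := ⟨(A.conductorNorm_pos_holds).ne'⟩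
  obtain ⟨Dm⟩ := hmod A
  obtain ⟨ϖ, hϖpos, hϖeq, -⟩ := Dm.exists_rat_mul_realPeriodRat_eq_plusPeriod
  obtain ⟨Ls, Lf, -, hPP⟩ := exists_isPollackPair_two Dm.isNewformOf hgood ha hL
  obtain ⟨D⟩ := nonempty_signedSelmerDualData A κ (1 : ℤˣ) hγ
  haveI := Kobayashi2003.SignedSelmerDualData.moduleFinite hγ D
  obtain ⟨hTors, g, hchar, hg⟩ := hMC κ γ hκ hγ hγ' Dm.f Dm.isNewformOf ϖ hϖeq Ls Lf hPP D
  -- constant terms: `g(0) = ϖ·[0]⁺_f = L(A,1)/Ω_A ≠ 0`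
  obtain ⟨hΦ0, ht⟩ := constantCoeff_neronPlus_two_eq A Dm.isNewformOf hgood ha hϖeq hPP
  have hΩ : (A.realPeriodRat : ℂ) ≠ 0 := Complex.ofReal_ne_zero.mpr A.realPeriodRat_pos_holds.ne'
  have ht0 : (ϖ * ratPlusSymbol Dm.f 0 : ℚ) ≠ 0 := by
    intro h0
    apply hL
    have h := ht
    rw [div_eq_iff hΩ, h0] at h
    rw [h]
    simp
  have hg0 : PowerSeries.constantCoeff g ≠ 0 := by
    intro h0
    have hc := congrArg PowerSeries.constantCoeff hg
    rw [constantCoeff_iwasawaToPowerSeries, h0, hΦ0, PadicInt.coe_zero] at hc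
    exact ht0 (by exact_mod_cast hc.symm)
  have hmem : g ∈ Literature.NumberTheory.EllipticCurves.Module.charIdeal (IwasawaAlgebra 2) D.X := by
    change g ∈ D.charIdeal
    rw [hchar]
    exact Ideal.mem_span_singleton_self g
  exact (D.isDualPair hγ).finite_coinvariants_iff.mp
    (IwasawaAlgebra.finite_coinvariants_of_constantCoeff_ne_zero 2 D.X hTors g hmem hg0)

end FiniteInvariants

/-! ## §2. The crux forces the analytic `μ`: `μ⁺ = 0` at one normalised pair + the identity `char X⁺ = (ϖ L♭)` ⇒ `μ(L♭) = 0` -/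

section AnalyticMu
variable (A : WeierstrassCurve ℚ) [A.IsElliptic] [A.IsGloballyMinimal]

/-- Two non-zero `p`-adic numbers with the same valuation differ by a unit of `ℤ_p`: `x = u · y`,
`u = x/y ∈ ℤ_pˣ` (`‖x/y‖ = 1`, `PadicInt.mkUnits`). [cite: Washington1997, §7.1] -/
theorem exists_units_mul_of_valuation_eq {p : ℕ} [Fact p.Prime] {x y : ℚ_[p]} (hx : x ≠ 0) (hy : y ≠ 0)
    (h : x.valuation = y.valuation) : ∃ u : ℤ_[p]ˣ, x = ((u : ℤ_[p]) : ℚ_[p]) * y := by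
  have hxy : ‖x‖ = ‖y‖ := by
    rw [Padic.norm_eq_zpow_neg_valuation hx, Padic.norm_eq_zpow_neg_valuation hy, h]
  have hz : ‖x / y‖ = 1 := by
    rw [norm_div, hxy, div_self (norm_ne_zero_iff.mpr hy)]
  refine ⟨PadicInt.mkUnits hz, ?_⟩
  rw [PadicInt.mkUnits_eq, div_mul_cancel₀ _ hy]

/-- **The crux forces the analytic `μ`: `μ(L♭) = 0`.** Let `W/ℚ` be globally minimal and good
supersingular at `2` (`GoodSS W 2`, so `W[2]` is irreducible), and grant the `p = 2` period-ratio fact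
`realPeriodRat_eq_unit_mul_plusPeriod_two` (`h2`, PUB, by name: `Ω_W = u·Ω⁺_f` with `u` a `2`-adic
unit, Abbes–Ullmo / Greenberg–Vatsal at `2`). If `KobayashiMainConjecture W 2 1` holds and `μ⁺ = 0`
for every dual datum at every NORMALISED cyclotomic pair (`hμ` — the `μ`-half of the crux's first
conjunct, restricted to `IsCyclotomicVariable 2 γ`), then for every newform `f` of `W` at level
`N = N_W` and every Pollack pair `(L⁺, L⁻)` at `2`, Kobayashi's `L⁺ = kobayashiL 1 L⁺ L⁻ = L♭` has a
unit coefficient. Chain: `ϖ = u⁻¹` is a period ratio of `f` with `ord₂ ϖ = 0`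
(`padicValRat_periodRatio_eq_zero_two`); at the tree's normalised pair
(`exists_isCyclotomic_isTopGenerator_isCyclotomicVariable_holds`) and a datum `D`, the conjecture gives
`char X⁺ = (g)`, `ι g = ϖ·ι L♭`; `μ(X⁺) = 0` iff a generator has a unit coefficient
(`muInvariant_eq_zero_iff_exists_isUnit_coeff_of_charIdeal_eq_span`); transfer along
`ι L♭ = ϖ⁻¹·ι g` (`isUnit_coeff_of_map_eq_C_mul`). The registered stub `stub_analyticMuFlatCMTwo` read
backwards: (μ♭_A) is NECESSARY for the crux. [cite: GreenbergVatsal2000, p. 2 and §3 Rem. 3.4]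
[cite: AbbesUllmo1996, Thm. A] [cite: Washington1997, §13.2] [cite: Kobayashi2003, Conjecture (p. 2)] -/
theorem exists_isUnit_coeff_kobayashiL_of_mu_eq_zero_two
    (h2 : Literature.NumberTheory.EllipticCurves.realPeriodRat_eq_unit_mul_plusPeriod_two)
    (hss : GoodSS A 2) (hMC : KobayashiMainConjecture A 2 1)
    (hμ : ∀ (κ : ZpExtension ℚ 2) (γ : Field.absoluteGaloisGroup ℚ),
      κ.IsCyclotomic → κ.IsTopGenerator γ → IsCyclotomicVariable 2 γ →
      ∀ D : SignedSelmerDualData A κ γ 1, D.mu = 0)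
    {N : ℕ} [NeZero N] {f : CuspForm (Gamma0 N) 2} (hN : N = A.conductorNorm ℤ) (hf : IsNewformOf A f)
    {Lplus Lminus : IwasawaAlgebra 2} (hPP : IsPollackPair f 2 Lplus Lminus) :
    ∃ n : ℕ, IsUnit (PowerSeries.coeff n (kobayashiL 1 Lplus Lminus)) := by
  subst hN
  -- the period ratio `ϖ = u⁻¹` of THIS newform (Abbes–Ullmo at `2`: `Ω_A = u · Ω⁺_f`, `u` a `2`-adic unit)
  obtain ⟨u, hu1, hΩ⟩ := h2 A hss.1 (P2.irr_two_of_goodSS_two A hss) f hf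
  have hΩpos : 0 < A.realPeriodRat := A.realPeriodRat_pos_holds
  have hu0 : u ≠ 0 := by
    rintro rfl
    rw [Rat.cast_zero, zero_mul] at hΩ
    exact hΩpos.ne' hΩ
  have hϖeq : ((u⁻¹ : ℚ) : ℝ) * A.realPeriodRat = plusPeriod f := by
    rw [hΩ, ← mul_assoc]
    have : ((u⁻¹ : ℚ) : ℝ) * (u : ℝ) = 1 := by
      rw [Rat.cast_inv, inv_mul_cancel₀ (by exact_mod_cast hu0)]
    rw [this, one_mul]
  have hϖv : padicValRat 2 (u⁻¹ : ℚ) = 0 := padicValRat_periodRatio_eq_zero_two A h2 hss hf hϖeq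
  -- a normalised cyclotomic pair and a dual datum; the conjecture there
  obtain ⟨κ, hκ, γ, hγ, hγ'⟩ := exists_isCyclotomic_isTopGenerator_isCyclotomicVariable_holds 2
  obtain ⟨D⟩ := nonempty_signedSelmerDualData A κ (1 : ℤˣ) hγ
  haveI := Kobayashi2003.SignedSelmerDualData.moduleFinite hγ D
  obtain ⟨hTors, g, hchar, hg⟩ := hMC κ γ hκ hγ hγ' f hf (u⁻¹ : ℚ) hϖeq Lplus Lminus hPP D
  -- `μ⁺ = 0` ⇒ a unit coefficient of `g` ⇒ a unit coefficient of `L♭ = ϖ⁻¹ g`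
  have hμ0 : muInvariant 2 D.X = 0 := hμ κ γ hκ hγ hγ' D
  obtain ⟨n, hn⟩ := (muInvariant_eq_zero_iff_exists_isUnit_coeff_of_charIdeal_eq_span D.X hTors hchar).mp hμ0
  have huQ : ((u⁻¹ : ℚ) : ℚ_[2]) ≠ 0 := by exact_mod_cast inv_ne_zero hu0
  have hg' : iwasawaToPowerSeries 2 (kobayashiL 1 Lplus Lminus) =
      PowerSeries.C (((u⁻¹ : ℚ)⁻¹ : ℚ) : ℚ_[2]) * iwasawaToPowerSeries 2 g := by
    rw [hg, ← mul_assoc, ← map_mul, Rat.cast_inv, inv_mul_cancel₀ huQ, map_one, one_mul]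
  exact ⟨n, isUnit_coeff_of_map_eq_C_mul (inv_ne_zero (inv_ne_zero hu0))
    (by rw [padicValRat.inv, hϖv, neg_zero]) hg' hn⟩

end AnalyticMu

/-! ## §3. The crux + BSD₂(A) force Kim's control term at `2` (at the normalised pairs) -/

section KimTerm
variable (A : WeierstrassCurve ℚ) [A.IsElliptic] [A.IsGloballyMinimal]

/-- **The crux + BSD₂ force B. D. Kim's control term at `2` (at the normalised pairs).** Let `W/ℚ` be
globally minimal, good supersingular at `2`, `a₂ = 0`, `L(W,1) ≠ 0`; grant modularity (`hmod`) and
Gross–Zagier–Kolyvagin (`hGZK`) by name, and `BSD(W,2)` (`hBSD`, Miller's `BSDp W 2` — for CM `W` of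
analytic rank `0` this is Burungale–Flach 2024, `bsdTriple_of_hasCM_of_L_one_ne_zero`). If
`KobayashiMainConjecture W 2 1` holds then for every normalised cyclotomic pair `(κ, γ)`, every dual
datum `D` of `Sel⁺(W/ℚ_∞)` and EVERY generator `g` of `char X⁺ = D.charIdeal`:
`g(0) = u · 2^{v₂ ∏c_ℓ} · #Sel_{2^∞}(W/ℚ)` for some `u ∈ ℤ₂ˣ` — verbatim the conclusion of the registered
stub `stub_kimControlCMTwo` (Kim 2013 Cor. 3.15 read at `2`), whose extra hypotheses (torsion,
`Sel` finite) are here consequences. Chain: the conjecture gives a generator `g₀` with `g₀(0) = t`,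
`t = L(W,1)/Ω_W` (`constantCoeff_neronPlus_two_eq`); `g = g₀·v⁻¹`, `v ∈ Λˣ` (`Λ` a domain,
`Ideal.span_singleton_eq_span_singleton`), so `ord₂ g(0) = ord₂ t`; BSD₂ with GZK:
`ord₂ t = ord₂ ∏c_ℓ + ord₂ #Ш` (`missingPPartAt_of_bsdp`, `shaAn_eq_of_analyticRank_eq_zero`,
`padicValRat_shaAn_witness`, `2 ∤ #tors` by `P2.irr_two_of_goodSS_two`); `#Sel_{2^∞} = #Ш[2^∞]` in rank
`0` (`natCard_selmerGroupPInfty_eq_natCard_primaryComponent_sha`) and `ord₂ #Ш[2^∞] = ord₂ #Ш`; equal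
valuations differ by a unit (`exists_units_mul_of_valuation_eq`). (K4c_A, normalised) is NECESSARY
for the crux given PUB. [cite: BDKim2013, Cor. 3.15 (p. 199; p odd in print)]
[cite: BurungaleFlach2024, Thm. 1.1] [cite: Miller2011LMS, Def. 1.1] [cite: GreenbergLNM1716, §1 p. 54 and §4 p. 103] -/
theorem kimControlTerm_two_of_kobayashiMainConjecture_two_one
    (hmod : nonempty_modularParametrizationData)
    (hGZK : rank_eq_analyticRank_of_analyticRank_le_one)
    (hss : GoodSS A 2) (ha : A.frobeniusTrace 2 = 0) (hL : A.entireLFunction 1 ≠ 0)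
    (hBSD : BSDp A 2) (hMC : KobayashiMainConjecture A 2 1)
    {κ : ZpExtension ℚ 2} {γ : Field.absoluteGaloisGroup ℚ} (hκ : κ.IsCyclotomic)
    (hγ : κ.IsTopGenerator γ) (hγ' : IsCyclotomicVariable 2 γ) (D : SignedSelmerDualData A κ γ 1)
    {g : IwasawaAlgebra 2} (hchar : D.charIdeal = Ideal.span {g}) :
    ∃ u : ℤ_[2]ˣ, ((PowerSeries.constantCoeff g : ℤ_[2]) : ℚ_[2]) =
      ((u : ℤ_[2]) : ℚ_[2]) * ((2 : ℕ) : ℚ_[2]) ^ (padicValNat 2 A.tamagawaProduct) *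
        (Nat.card (A.selmerGroupPInfty 2) : ℚ_[2]) := by
  have hr : A.analyticRank = 0 := analyticRank_eq_zero_of_entireLFunction_one_ne_zero A hL
  have hirr : A.HasIrreducibleModPGaloisRep 2 := P2.irr_two_of_goodSS_two A hss
  have hr0 : A.mordellWeilRank = 0 := (hGZK A (by omega)).1.trans hr
  haveI hfinE : Finite A.toAffine.Point := A.mordellWeilRank_eq_zero_iff_finite.mp hr0
  haveI hfinSha : Finite A.sha := (hGZK A (by omega)).2
  -- modularity: a newform, its period ratio, a Pollack pair at `2`; the conjecture: `char X⁺ = (g₀)`, `g₀(0) = t`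
  haveI : NeZero (A.conductorNorm ℤ) := ⟨(A.conductorNorm_pos_holds).ne'⟩
  obtain ⟨Dm⟩ := hmod A
  obtain ⟨ϖ, hϖpos, hϖeq, -⟩ := Dm.exists_rat_mul_realPeriodRat_eq_plusPeriod
  obtain ⟨Ls, Lf, -, hPP⟩ := exists_isPollackPair_two Dm.isNewformOf hss.1 ha hL
  haveI := Kobayashi2003.SignedSelmerDualData.moduleFinite hγ D
  obtain ⟨hTors, g₀, hchar₀, hg₀⟩ := hMC κ γ hκ hγ hγ' Dm.f Dm.isNewformOf ϖ hϖeq Ls Lf hPP D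
  obtain ⟨hΦ0, ht⟩ := constantCoeff_neronPlus_two_eq A Dm.isNewformOf hss.1 ha hϖeq hPP
  set t : ℚ := ϖ * ratPlusSymbol Dm.f 0 with ht_def
  have hΩ : (A.realPeriodRat : ℂ) ≠ 0 := Complex.ofReal_ne_zero.mpr A.realPeriodRat_pos_holds.ne'
  have ht0 : t ≠ 0 := by
    intro h0
    apply hL
    have h := ht
    rw [div_eq_iff hΩ, h0] at h
    rw [h]
    simp
  have hg₀0 : ((PowerSeries.constantCoeff g₀ : ℤ_[2]) : ℚ_[2]) = ((t : ℚ) : ℚ_[2]) := by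
    have hc := congrArg PowerSeries.constantCoeff hg₀
    rw [constantCoeff_iwasawaToPowerSeries, hΦ0] at hc
    exact hc
  -- the two generators differ by a unit of `Λ`: `g₀ = g · v`
  have hassoc : Associated g g₀ := by
    rw [← Ideal.span_singleton_eq_span_singleton]
    exact hchar.symm.trans hchar₀
  obtain ⟨v, hv⟩ := hassoc
  have hv0 : IsUnit (PowerSeries.constantCoeff (v : IwasawaAlgebra 2)) :=
    PowerSeries.isUnit_constantCoeff _ v.isUnit
  obtain ⟨w, hw⟩ := hv0
  -- BSD₂(A): `ord₂ t = ord₂ ∏c_ℓ + ord₂ #Ш`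
  obtain ⟨q, hq, hvq⟩ := missingPPartAt_of_bsdp A 2 hBSD
  have hsha := shaAn_eq_of_analyticRank_eq_zero A hGZK hr ht
  have hqt : q = t * (A.torsionOrder : ℚ) ^ 2 / (A.tamagawaProduct : ℚ) := by
    have h := hq.symm.trans hsha
    exact_mod_cast h
  rw [hqt, padicValRat_shaAn_witness A 2 hirr ht0] at hvq
  -- `#Sel_{2^∞}(A/ℚ) = #Ш[2^∞]`, `ord₂ #Ш[2^∞] = ord₂ #Ш`
  have hSel : Nat.card (A.selmerGroupPInfty 2) = Nat.card (AddCommGroup.primaryComponent A.sha 2) :=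
    A.natCard_selmerGroupPInfty_eq_natCard_primaryComponent_sha 2
  have hcardpos : 0 < Nat.card (AddCommGroup.primaryComponent A.sha 2) := Nat.card_pos
  have hvSel : padicValNat 2 (Nat.card (A.selmerGroupPInfty 2)) = padicValNat 2 A.shaOrder := by
    rw [hSel, padicValNat_card_addPrimaryComponent (A := A.sha) 2, WeierstrassCurve.shaOrder]
  -- valuations: `ord₂ g(0) = ord₂ g₀(0) = ord₂ t = ord₂ (2^{v₂ ∏c} · #Sel)`
  set P : ℚ_[2] := ((2 : ℕ) : ℚ_[2]) ^ (padicValNat 2 A.tamagawaProduct) * (Nat.card (A.selmerGroupPInfty 2) : ℚ_[2])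
    with hP_def
  have hpow : ((2 : ℕ) : ℚ_[2]) ^ (padicValNat 2 A.tamagawaProduct) =
      ((2 ^ (padicValNat 2 A.tamagawaProduct) : ℕ) : ℚ_[2]) := by norm_cast
  have hS0 : ((Nat.card (A.selmerGroupPInfty 2) : ℕ) : ℚ_[2]) ≠ 0 := by
    rw [hSel]; exact_mod_cast hcardpos.ne'
  have hP2 : ((2 ^ (padicValNat 2 A.tamagawaProduct) : ℕ) : ℚ_[2]) ≠ 0 := by
    exact_mod_cast pow_ne_zero _ two_ne_zero
  have hP0 : P ≠ 0 := by rw [hP_def, hpow]; exact mul_ne_zero hP2 hS0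
  have hvalP : P.valuation = padicValRat 2 t := by
    rw [hP_def, hpow, Padic.valuation_mul hP2 hS0, Padic.valuation_natCast, Padic.valuation_natCast,
      padicValNat.prime_pow, hvSel]
    linarith
  have htQ0 : ((t : ℚ) : ℚ_[2]) ≠ 0 := by exact_mod_cast ht0
  have hw0 : ((w : ℤ_[2]) : ℚ_[2]) ≠ 0 := coe_units_ne_zero 2 w
  have hgt : ((PowerSeries.constantCoeff g : ℤ_[2]) : ℚ_[2]) * ((w : ℤ_[2]) : ℚ_[2]) = ((t : ℚ) : ℚ_[2]) := by
    rw [← hg₀0, ← hv, map_mul, ← hw, PadicInt.coe_mul]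
  have hgQ0 : ((PowerSeries.constantCoeff g : ℤ_[2]) : ℚ_[2]) ≠ 0 := by
    intro h0
    rw [h0, zero_mul] at hgt
    exact htQ0 hgt.symm
  have hvalg : (((PowerSeries.constantCoeff g : ℤ_[2]) : ℚ_[2])).valuation = padicValRat 2 t := by
    have h := congrArg Padic.valuation hgt
    rw [Padic.valuation_mul hgQ0 hw0, valuation_coe_units_eq_zero, add_zero, Padic.valuation_ratCast] at h
    exact h
  obtain ⟨u, hu⟩ := exists_units_mul_of_valuation_eq hgQ0 hP0 (hvalg.trans hvalP.symm)
  exact ⟨u, by rw [hu, hP_def, mul_assoc]⟩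

end KimTerm

end Summit.BirchSwinnertonDyer.BirchSwinnertonDyer.Theorems

end
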